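import Mathlib
import Summits.MatrixMultiplication.MatrixMultiplication.Theses.SnSubsetDichotomy

/-!
# The window gain and BCCGU peeling for subsets — line `mover-covering-amgm`, crux `JuntaBranch`
# (stmt-MatrixMultiplication-8304)

The PROVED mechanism of line `mover-covering-amgm`, made importable (the line itself is dead: its
structural stub is inert without largeness and self-defeating with it, see
`Theorems/SnSubsetDichotomyJuntaBranchPartnersDisjointBoundary.lean` and the line's dead note):

* `windowGain` — pure counting: at a block of size `t` with `2n^{(1-ε)/2} ≤ t ≤ √n` (`n ≥ n₀(ε,c)`), an
  `ε`-super-neutral first set (`n^{(1/2+ε)t}|S| < |S_I|·n^{(t)}`) and two partners with AM–GM-scale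
  atoms (`|T_J| ≥ |T|(t/n)^t`, `|U_P| ≥ |U|(t/n)^t`) have JOINT GAIN
  `e^{c+1}|S||T||U|((n-t)!/n!)^{3/2} ≤ |S_I||T_J||U_P|` (squared gain `≥ (n^{2ε-2}t⁴/2)^t ≥ 8^t`).
* (in the companion file `Theorems/SnSubsetDichotomyJuntaBranchDisjointSourcesPeeling.lean`)
  `juntaBranch_of_disjointSources` — BCCGU17 Thm 4.2 (arXiv:1712.02302) for SUBSETS, kernel-checked:
  a TPP triple of `S_n` whose first set is `ε`-super-neutral at a block `(I→L)` of size
  `t ∈ [2n^{(1-ε)/2}, √n]` and whose partners have pairwise-disjoint source supports on `L` satisfies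
  the conclusion of the crux `JuntaBranch` (an `e^{c+1}`-improved TPP triple at level `n - t`):
  `amgmAtom` twice, `windowGain`, and cashing by the route item `UmvirateDescent` (tree theorem
  `Theorems.umvirateDescent_proof`) + window arithmetic (as in `Theorems.JuntaBranch.stub_cash`).
  No largeness and no saturation are needed; in the Young case the disjointness is BCCGU's "the
  parts of H₂ met by the peeled block are distinct".
-/

open Literature.Combinatorics.Additive
open scoped Classical

set_option linter.dupNamespace false

namespace Summit.MatrixMultiplication.MatrixMultiplication.Theorems.JuntaBranch

/-- `log 8 > 2` (from `e < 2.7182818286`). -/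
theorem two_lt_log_eight : (2 : ℝ) < Real.log 8 := by
  rw [Real.lt_log_iff_exp_lt (by norm_num)]
  have h := Real.exp_one_lt_d9
  have e : Real.exp 2 = Real.exp 1 ^ 2 := by
    rw [← Real.exp_nat_mul]; norm_num
  rw [e]
  nlinarith [Real.exp_pos 1]

/-- The core real inequality behind `windowGain`: for `n ≥ 4`, `n ≥ (c+1)^4`, `0 < ε < 1/2`,
`2n^{(1-ε)/2} ≤ t ≤ √n` and `D ≥ (n/2)^t`: `e^{2(c+1)} ≤ 8^t ≤ (n^{1+2ε}(t/n)^4(n/2))^t ≤ E² q⁴ D`. -/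
theorem windowGain_core (ε c : ℝ) (hε : 0 < ε) (hε2 : ε < 1 / 2) (hc : 0 < c) (n t : ℕ)
    (hn4 : (4 : ℝ) ≤ n) (hnc : (c + 1) ^ 4 ≤ (n : ℝ)) (_htn : (t : ℝ) ≤ Real.sqrt n)
    (hlo : 2 * (n : ℝ) ^ ((1 - ε) / 2) ≤ t) (D : ℝ) (hD : ((n : ℝ) / 2) ^ t ≤ D) :
    Real.exp (c + 1) ^ 2 ≤
      ((n : ℝ) ^ ((1 / 2 + ε) * (t : ℝ))) ^ 2 * (((t : ℝ) / n) ^ t) ^ 4 * D := by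
  have hnpos : (0 : ℝ) < n := by linarith
  have hn0 : (0 : ℝ) ≤ n := hnpos.le
  have hn1 : (1 : ℝ) ≤ n := by linarith
  -- t ≥ 2(c+1)
  have hγ : (1 : ℝ) / 4 ≤ (1 - ε) / 2 := by linarith
  have hnγ : c + 1 ≤ (n : ℝ) ^ ((1 - ε) / 2) := by
    have h1 : (n : ℝ) ^ ((1 : ℝ) / 4) ≤ (n : ℝ) ^ ((1 - ε) / 2) :=
      Real.rpow_le_rpow_of_exponent_le hn1 hγ
    have hc1 : (0 : ℝ) ≤ c + 1 := by linarith
    have h2 : c + 1 ≤ (n : ℝ) ^ ((1 : ℝ) / 4) := by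
      calc c + 1 = ((c + 1) ^ 4) ^ ((1 : ℝ) / 4) := by
            rw [← Real.rpow_natCast, ← Real.rpow_mul hc1]; norm_num
        _ ≤ (n : ℝ) ^ ((1 : ℝ) / 4) := Real.rpow_le_rpow (by positivity) hnc (by norm_num)
    linarith
  have ht2c : 2 * (c + 1) ≤ (t : ℝ) := by linarith
  have ht0 : (0 : ℝ) ≤ t := Nat.cast_nonneg t
  -- exp(c+1)^2 ≤ 8^t
  have h8 : Real.exp (c + 1) ^ 2 ≤ (8 : ℝ) ^ t := by
    rw [← Real.exp_nat_mul]
    have e8 : (8 : ℝ) ^ t = Real.exp (t * Real.log 8) := by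
      rw [Real.exp_nat_mul, Real.exp_log (by norm_num)]
    rw [e8, Real.exp_le_exp]
    have hl := two_lt_log_eight
    push_cast
    nlinarith [mul_nonneg ht0 (sub_nonneg.mpr hl.le)]
  -- t² ≥ 4 n^{1-ε}, t⁴ ≥ 16 n^{2-2ε}
  have hsq : 4 * (n : ℝ) ^ (1 - ε) ≤ (t : ℝ) ^ 2 := by
    have h0 : (0 : ℝ) ≤ 2 * (n : ℝ) ^ ((1 - ε) / 2) := by positivity
    have h1 := pow_le_pow_left₀ h0 hlo 2
    have e : (2 * (n : ℝ) ^ ((1 - ε) / 2)) ^ 2 = 4 * (n : ℝ) ^ (1 - ε) := by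
      rw [mul_pow, ← Real.rpow_natCast ((n : ℝ) ^ ((1 - ε) / 2)) 2, ← Real.rpow_mul hn0]
      norm_num
    rw [e] at h1
    exact h1
  have ht4 : 16 * ((n : ℝ) ^ (1 - ε)) ^ 2 ≤ (t : ℝ) ^ 4 := by
    have h0 : (0 : ℝ) ≤ 4 * (n : ℝ) ^ (1 - ε) := by positivity
    have h1 := pow_le_pow_left₀ h0 hsq 2
    have e1 : (4 * (n : ℝ) ^ (1 - ε)) ^ 2 = 16 * ((n : ℝ) ^ (1 - ε)) ^ 2 := by ring
    have e2 : ((t : ℝ) ^ 2) ^ 2 = (t : ℝ) ^ 4 := by ring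
    rw [e1, e2] at h1
    exact h1
  have key : (n : ℝ) ^ (1 + 2 * ε) * ((n : ℝ) ^ (1 - ε)) ^ 2 = (n : ℝ) ^ 3 := by
    rw [← Real.rpow_natCast ((n : ℝ) ^ (1 - ε)) 2, ← Real.rpow_mul hn0,
      ← Real.rpow_add hnpos]
    rw [show (1 + 2 * ε + (1 - ε) * ((2 : ℕ) : ℝ)) = ((3 : ℕ) : ℝ) by push_cast; ring,
      Real.rpow_natCast]
  have hB : (8 : ℝ) ≤ (n : ℝ) ^ (1 + 2 * ε) * ((t : ℝ) / n) ^ 4 * ((n : ℝ) / 2) := by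
    have hA : 0 ≤ (n : ℝ) ^ (1 + 2 * ε) := by positivity
    calc (8 : ℝ) = (n : ℝ) ^ (1 + 2 * ε) * (16 * ((n : ℝ) ^ (1 - ε)) ^ 2) / (n : ℝ) ^ 4 *
          ((n : ℝ) / 2) := by
          rw [show (n : ℝ) ^ (1 + 2 * ε) * (16 * ((n : ℝ) ^ (1 - ε)) ^ 2) = 16 * (n : ℝ) ^ 3 by
            rw [mul_left_comm, key]]
          field_simp
          ring
      _ ≤ (n : ℝ) ^ (1 + 2 * ε) * (t : ℝ) ^ 4 / (n : ℝ) ^ 4 * ((n : ℝ) / 2) := by gcongr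
      _ = (n : ℝ) ^ (1 + 2 * ε) * ((t : ℝ) / n) ^ 4 * ((n : ℝ) / 2) := by rw [div_pow]; ring
  -- assemble
  have hE2 : ((n : ℝ) ^ ((1 / 2 + ε) * (t : ℝ))) ^ 2 = ((n : ℝ) ^ (1 + 2 * ε)) ^ t := by
    rw [← Real.rpow_natCast ((n : ℝ) ^ ((1 / 2 + ε) * (t : ℝ))) 2, ← Real.rpow_mul hn0,
      ← Real.rpow_natCast ((n : ℝ) ^ (1 + 2 * ε)) t, ← Real.rpow_mul hn0]
    congr 1
    push_cast
    ring
  have hq4 : (((t : ℝ) / n) ^ t) ^ 4 = (((t : ℝ) / n) ^ 4) ^ t := by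
    rw [← pow_mul, ← pow_mul, mul_comm]
  calc Real.exp (c + 1) ^ 2 ≤ (8 : ℝ) ^ t := h8
    _ ≤ ((n : ℝ) ^ (1 + 2 * ε) * ((t : ℝ) / n) ^ 4 * ((n : ℝ) / 2)) ^ t :=
        pow_le_pow_left₀ (by norm_num) hB t
    _ = ((n : ℝ) ^ (1 + 2 * ε)) ^ t * (((t : ℝ) / n) ^ 4) ^ t * ((n : ℝ) / 2) ^ t := by
        rw [mul_pow, mul_pow]
    _ ≤ ((n : ℝ) ^ (1 + 2 * ε)) ^ t * (((t : ℝ) / n) ^ 4) ^ t * D := by gcongr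
    _ = ((n : ℝ) ^ ((1 / 2 + ε) * (t : ℝ))) ^ 2 * (((t : ℝ) / n) ^ t) ^ 4 * D := by
        rw [hE2, hq4]

/-- **The window gain (the card's arithmetic, triage-corrected; proved by the crux-plan planner of line
`mover-covering-amgm` in the workfile, moved to the tree by lead gen 1 with the line vocabulary unfolded) —
why the band starts at `2n^{(1−ε)/2}`.** For `ε, c > 0` and `n ≥ n₀(ε,c)`, at any block of size `t` with
`t_lo(ε,n) ≤ t ≤ √n`: an `ε`-super-neutral first set and two partners with AM–GM-scale atoms
(`|T_J| ≥ |T|(t/n)^t`, `|U_P| ≥ |U|(t/n)^t`) have `JointGain c` — no TPP, no largeness, pure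
counting: `((n−t)!/n!) = 1/n^{(t)}`, `n^{(t)} ≥ (n+1−t)^t ≥ (n/2)^t`, so the squared gain is
`≥ (n^{2ε−2}t⁴/2)^t ≥ 8^t ≥ e^{2(c+1)}` once `t ≥ t_lo ≥ 2(c+1)` (`n ≥ (c+1)^4 + 4`); for `ε ≥ 1/2`
no set is super-neutral (`n^{(t)} ≤ n^t ≤ n^{(1/2+ε)t}`), so the hypothesis is contradictory. -/
theorem windowGain :
    ∀ ε : ℝ, 0 < ε → ∀ c : ℝ, 0 < c → ∃ n₀ : ℕ, ∀ n ≥ n₀, ∀ t : ℕ,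
      2 * (n : ℝ) ^ ((1 - ε) / 2) ≤ (t : ℝ) → (t : ℝ) ≤ Real.sqrt (n : ℝ) →
      ∀ S T U : Finset (Equiv.Perm (Fin n)), ∀ L I J P : Fin t → Fin n,
      (n : ℝ) ^ ((1 / 2 + ε) * t) * (S.card : ℝ) <
        ((S.filter (fun σ => ∀ k, σ (I k) = L k)).card : ℝ) * (n.descFactorial t : ℝ) →
      (T.card : ℝ) * ((t : ℝ) / n) ^ t ≤ ((T.filter (fun σ => ∀ k, σ (J k) = L k)).card : ℝ) →
      (U.card : ℝ) * ((t : ℝ) / n) ^ t ≤ ((U.filter (fun σ => ∀ k, σ (P k) = L k)).card : ℝ) →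
      Real.exp (c + 1) * ((S.card * T.card * U.card : ℕ) : ℝ) *
          (((n - t).factorial : ℝ) / (n.factorial : ℝ)) ^ ((3 : ℝ) / 2) ≤
        (((S.filter (fun σ => ∀ k, σ (I k) = L k)).card *
            (T.filter (fun σ => ∀ k, σ (J k) = L k)).card *
            (U.filter (fun σ => ∀ k, σ (P k) = L k)).card : ℕ) : ℝ) := by
  intro ε hε c hc
  by_cases hε2 : ε < 1 / 2
  · refine ⟨⌈(c + 1) ^ 4⌉₊ + 4, ?_⟩
    intro n hn t hlo htn S T U L I J P hS hT hU
    -- basic facts about n, t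
    have hn' : ⌈(c + 1) ^ 4⌉₊ + 4 ≤ n := hn
    have hn4 : (4 : ℝ) ≤ n := by
      have h4 : (4 : ℕ) ≤ n := le_trans (Nat.le_add_left 4 _) hn'
      exact_mod_cast h4
    have hnc : (c + 1) ^ 4 ≤ (n : ℝ) := by
      have h1 : ⌈(c + 1) ^ 4⌉₊ ≤ n := le_trans (Nat.le_add_right _ 4) hn'
      exact le_trans (Nat.le_ceil _) (by exact_mod_cast h1)
    have hnpos : (0 : ℝ) < n := by linarith
    have htn2 : (t : ℝ) ≤ n / 2 := by
      refine le_trans htn ?_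
      rw [Real.sqrt_le_left (by positivity)]
      nlinarith
    have htn_nat : t ≤ n := by
      have h : (t : ℝ) ≤ n := by linarith
      exact_mod_cast h
    -- D := n^{(t)} facts
    have hDpos : (0 : ℝ) < (n.descFactorial t : ℝ) := by
      have h : n.descFactorial t ≠ 0 := fun h0 =>
        absurd (Nat.descFactorial_eq_zero_iff_lt.mp h0) (not_lt.mpr htn_nat)
      exact_mod_cast Nat.pos_of_ne_zero h
    have hDlow : ((n : ℝ) / 2) ^ t ≤ (n.descFactorial t : ℝ) := by
      have h1 : (n + 1 - t) ^ t ≤ n.descFactorial t := Nat.pow_sub_le_descFactorial n t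
      have h2 : (n : ℝ) / 2 ≤ ((n + 1 - t : ℕ) : ℝ) := by
        rw [Nat.cast_sub (by omega)]
        push_cast
        linarith
      calc ((n : ℝ) / 2) ^ t ≤ ((n + 1 - t : ℕ) : ℝ) ^ t := pow_le_pow_left₀ (by positivity) h2 t
        _ ≤ (n.descFactorial t : ℝ) := by exact_mod_cast h1
    -- the ratio (n-t)!/n! = 1/D
    have hf0 : (n.factorial : ℝ) ≠ 0 := by positivity
    have hfac : ((n - t).factorial : ℝ) * (n.descFactorial t : ℝ) = (n.factorial : ℝ) := by
      exact_mod_cast Nat.factorial_mul_descFactorial htn_nat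
    have hr : ((n - t).factorial : ℝ) / (n.factorial : ℝ) = (n.descFactorial t : ℝ)⁻¹ := by
      rw [div_eq_iff hf0, ← hfac]
      field_simp
    -- the core inequality and its square root
    have hcore := windowGain_core ε c hε hε2 hc n t hn4 hnc htn hlo (n.descFactorial t : ℝ) hDlow
    have h0 : 0 ≤ (n : ℝ) ^ ((1 / 2 + ε) * (t : ℝ)) * (((t : ℝ) / n) ^ t) ^ 2 *
        Real.sqrt (n.descFactorial t : ℝ) := by positivity
    have hx : Real.exp (c + 1) ≤ (n : ℝ) ^ ((1 / 2 + ε) * (t : ℝ)) * (((t : ℝ) / n) ^ t) ^ 2 *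
        Real.sqrt (n.descFactorial t : ℝ) := by
      have hsq : Real.exp (c + 1) ^ 2 ≤ ((n : ℝ) ^ ((1 / 2 + ε) * (t : ℝ)) *
          (((t : ℝ) / n) ^ t) ^ 2 * Real.sqrt (n.descFactorial t : ℝ)) ^ 2 := by
        calc Real.exp (c + 1) ^ 2 ≤ ((n : ℝ) ^ ((1 / 2 + ε) * (t : ℝ))) ^ 2 *
              (((t : ℝ) / n) ^ t) ^ 4 * (n.descFactorial t : ℝ) := hcore
          _ = ((n : ℝ) ^ ((1 / 2 + ε) * (t : ℝ)) * (((t : ℝ) / n) ^ t) ^ 2 *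
              Real.sqrt (n.descFactorial t : ℝ)) ^ 2 := by
            rw [mul_pow, mul_pow, Real.sq_sqrt hDpos.le]; ring
      have h1 := Real.sqrt_le_sqrt hsq
      rwa [Real.sqrt_sq (Real.exp_pos _).le, Real.sqrt_sq h0] at h1
    -- partner atoms and the bump
    have ha' : (n : ℝ) ^ ((1 / 2 + ε) * (t : ℝ)) * (S.card : ℝ) / (n.descFactorial t : ℝ) ≤
        ((S.filter (fun σ => ∀ k, σ (I k) = L k)).card : ℝ) := by
      rw [div_le_iff₀ hDpos]
      exact hS.le
    have hq0 : 0 ≤ ((t : ℝ) / n) ^ t := by positivity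
    have hprod : ((n : ℝ) ^ ((1 / 2 + ε) * (t : ℝ)) * (S.card : ℝ) / (n.descFactorial t : ℝ)) *
        ((T.card : ℝ) * ((t : ℝ) / n) ^ t) * ((U.card : ℝ) * ((t : ℝ) / n) ^ t) ≤
        ((S.filter (fun σ => ∀ k, σ (I k) = L k)).card : ℝ) *
        ((T.filter (fun σ => ∀ k, σ (J k) = L k)).card : ℝ) *
        ((U.filter (fun σ => ∀ k, σ (P k) = L k)).card : ℝ) := by
      have h1 := mul_le_mul ha' hT (by positivity) (Nat.cast_nonneg _)
      exact mul_le_mul h1 hU (by positivity) (by positivity)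
    -- the key identity √D · (D⁻¹)^{3/2} = D⁻¹
    have hid : Real.sqrt (n.descFactorial t : ℝ) * ((n.descFactorial t : ℝ)⁻¹) ^ ((3 : ℝ) / 2) =
        (n.descFactorial t : ℝ)⁻¹ := by
      rw [Real.sqrt_eq_rpow, Real.inv_rpow hDpos.le, ← Real.rpow_neg hDpos.le,
        ← Real.rpow_add hDpos, show (1 : ℝ) / 2 + -((3 : ℝ) / 2) = -1 by norm_num,
        Real.rpow_neg_one]
    -- finish
    have hV0 : 0 ≤ ((S.card * T.card * U.card : ℕ) : ℝ) := Nat.cast_nonneg _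
    have hr0 : 0 ≤ ((n.descFactorial t : ℝ)⁻¹) ^ ((3 : ℝ) / 2) :=
      Real.rpow_nonneg (inv_nonneg.mpr hDpos.le) _
    rw [hr]
    calc Real.exp (c + 1) * ((S.card * T.card * U.card : ℕ) : ℝ) *
          ((n.descFactorial t : ℝ)⁻¹) ^ ((3 : ℝ) / 2)
        ≤ ((n : ℝ) ^ ((1 / 2 + ε) * (t : ℝ)) * (((t : ℝ) / n) ^ t) ^ 2 *
            Real.sqrt (n.descFactorial t : ℝ)) * ((S.card * T.card * U.card : ℕ) : ℝ) *
          ((n.descFactorial t : ℝ)⁻¹) ^ ((3 : ℝ) / 2) :=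
          mul_le_mul_of_nonneg_right (mul_le_mul_of_nonneg_right hx hV0) hr0
      _ = ((n : ℝ) ^ ((1 / 2 + ε) * (t : ℝ)) * (S.card : ℝ) / (n.descFactorial t : ℝ)) *
          ((T.card : ℝ) * ((t : ℝ) / n) ^ t) * ((U.card : ℝ) * ((t : ℝ) / n) ^ t) := by
          have e : ((n : ℝ) ^ ((1 / 2 + ε) * (t : ℝ)) * (((t : ℝ) / n) ^ t) ^ 2 *
              Real.sqrt (n.descFactorial t : ℝ)) * ((S.card * T.card * U.card : ℕ) : ℝ) *
              ((n.descFactorial t : ℝ)⁻¹) ^ ((3 : ℝ) / 2) =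
              (n : ℝ) ^ ((1 / 2 + ε) * (t : ℝ)) * (((t : ℝ) / n) ^ t) ^ 2 *
              ((S.card * T.card * U.card : ℕ) : ℝ) *
              (Real.sqrt (n.descFactorial t : ℝ) *
                ((n.descFactorial t : ℝ)⁻¹) ^ ((3 : ℝ) / 2)) := by ring
          rw [e, hid]
          push_cast
          field_simp
      _ ≤ _ := hprod
      _ = _ := by push_cast; ring
  · -- ε ≥ 1/2: no set is ever super-neutral, the hypothesis is contradictory
    refine ⟨1, ?_⟩
    intro n hn t hlo htn S T U L I J P hS hT hU
    exfalso
    have hn1 : (1 : ℝ) ≤ n := by exact_mod_cast hn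
    have hε2' : 1 / 2 ≤ ε := not_lt.mp hε2
    have hsub : ((S.filter (fun σ => ∀ k, σ (I k) = L k)).card : ℝ) ≤ (S.card : ℝ) := by
      exact_mod_cast Finset.card_filter_le _ _
    have hD : (n.descFactorial t : ℝ) ≤ (n : ℝ) ^ ((1 / 2 + ε) * (t : ℝ)) := by
      have h1 : (n.descFactorial t : ℝ) ≤ ((n ^ t : ℕ) : ℝ) := by
        exact_mod_cast Nat.descFactorial_le_pow n t
      have h2 : ((n ^ t : ℕ) : ℝ) = (n : ℝ) ^ ((t : ℕ) : ℝ) := by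
        push_cast
        rw [Real.rpow_natCast]
      have h3 : (n : ℝ) ^ ((t : ℕ) : ℝ) ≤ (n : ℝ) ^ ((1 / 2 + ε) * (t : ℝ)) := by
        apply Real.rpow_le_rpow_of_exponent_le hn1
        have ht0 : (0 : ℝ) ≤ t := Nat.cast_nonneg t
        nlinarith
      linarith [h2 ▸ h1]
    have hE0 : 0 ≤ (n : ℝ) ^ ((1 / 2 + ε) * (t : ℝ)) := by positivity
    have := mul_le_mul hsub hD (Nat.cast_nonneg _) (Nat.cast_nonneg _)
    linarith [mul_comm ((n : ℝ) ^ ((1 / 2 + ε) * (t : ℝ))) (S.card : ℝ)]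



end Summit.MatrixMultiplication.MatrixMultiplication.Theorems.JuntaBranch
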